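import Literature.Analysis.FluidPDE.LinearisedNSFourierForcedIteration
import Literature.Analysis.FluidPDE.LinearisedNSFourierTimeRegularity
import HarnessLib

/-!
# Time regularity of the Fourier-side solution of the linearised Navier–Stokes equation with a source

Analysis/FluidPDE proof file, fourth of the files `LinearisedNSFourierForced*` (objects in
`LinearisedNSFourierForcedDefs`; the forced Picard limit in `LinearisedNSFourierForcedIteration`),
the inhomogeneous twin of `LinearisedNSFourierTimeRegularity` (Constantin–Foias 1988, Ch. 14,
(14.3)–(14.4) with a source):

* `PicardHypF.hasDerivWithinAt_picardLimF` — **mild ⇒ differential**: on `[0, T]` the forced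
  Picard limit satisfies `∂ₜ c(l,t,k) = -νₖ c(l,t,k) - (P linSym)(U(t), c(t))(l,k) + (P G(t))ₗ(k)`
  as a derivative within `[0, T]` (product rule and the fundamental theorem of calculus on
  `c = e^{-νₖt} a + e^{-νₖt}∫₀ᵗ e^{νₖs}(-(P linSym)(s) + (P G)(s)) ds`; Lemarié-Rieusset 2016, §8.5);
* `IsCoeffFamily.srcProjFamily`, `IsCoeffFamily.bootRHSF'` — closure of coefficient families
  under the projected source family and the forced bootstrap right-hand side (the Leray entries
  are time-independent symbols bounded by `2`; the homogeneous part is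
  `IsCoeffFamily.bootRHS'`);
* `PicardHypF.exists_coeffFamilyF` — **families of all orders**: if the drift and the source
  coefficients are, on `[0, T]`, the zeroth members of families of every order (the
  coefficients of `∂ₜⁱuⱼ`, `∂ₜⁱgⱼ`), then every component `c l` of the forced Picard limit starts
  a coefficient family of every order `n`, by the bootstrap
  `Wᵢ₊₁ := -νₖ Wᵢ - (P linSym)ᵢ + (P G)ᵢ`.

## References

* P. Constantin, C. Foias, *Navier–Stokes Equations*, Univ. Chicago Press 1988, Ch. 14, (14.3)–(14.4). [`ConstantinFoiasNSE1988`]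
* P. G. Lemarié-Rieusset, *The Navier–Stokes problem in the 21st century*, CRC 2016, §8.5
  (equivalence of mild and differential formulations).
-/

noncomputable section

open MeasureTheory Real Set Filter Topology UnitAddTorus

namespace Literature.Analysis.FluidPDE

namespace LinearisedNSFourier

open ScalarFourier
open CorrectorFourier (leraySym norm_leraySym_le)
open FourierNS (HasDecay clamp)
open Literature.Analysis.FunctionSpaces.Torus (freqNormSq)

variable {d : Type*} [Fintype d] [DecidableEq d]
variable {ν T : ℝ} {U G : d → ℝ → (d → ℤ) → ℂ} {a : d → (d → ℤ) → ℂ}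

/-! ### Mild ⇒ differential -/

/-- **Mild ⇒ differential, with source.** The forced Picard limit `c` satisfies, at every
component `l`, frequency `k` and `t ∈ [0, T]`,
`∂ₜ c(l,t,k) = -νₖ c(l,t,k) - (P linSym)(U(t), c(t))(l,k) + (P G(t))ₗ(k)` as a derivative
within `[0, T]` (differentiate `c(t) = e^{-νₖt} a + e^{-νₖt} ∫₀ᵗ e^{νₖs} (-(P linSym)(s) + (P G)(s)) ds`
by the product rule and the fundamental theorem of calculus; Lemarié-Rieusset 2016, §8.5). [folklore] -/
theorem PicardHypF.hasDerivWithinAt_picardLimF (h : PicardHypF ν T U G a) (l : d) (k : d → ℤ) {t : ℝ}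
    (ht : t ∈ Icc 0 T) :
    HasDerivWithinAt (fun s => picardLimF ν T U G a l s k)
      (-(heatRate ν k : ℂ) * picardLimF ν T U G a l t k -
        linProjSym (fun j => U j t) (fun j => picardLimF ν T U G a j t) l k +
        srcProj (fun j => G j t) l k) (Icc 0 T) t := by
  set c := picardLimF ν T U G a with hc
  set r := heatRate ν k with hr
  obtain ⟨R, -, hcd⟩ := h.hasDecay_picardLimF (latOrder d + 1)
  have hcc : ∀ l m, Continuous fun t => c l t m := h.continuous_picardLimF
  set N : ℝ → ℂ := fun s => linProjSym (fun j => U j s) (fun j => c j s) l k with hN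
  set Sg : ℝ → ℂ := fun s => srcProj (fun j => G j s) l k with hSg
  have hNc : Continuous N := h.toPicardHyp.continuous_linProjSym hcc hcd l k
  have hSgc : Continuous Sg := h.continuous_srcProj l k
  set P : ℝ → ℂ := fun s => -N s + Sg s with hP
  have hPc : Continuous P := hNc.neg.add hSgc
  -- `Gi s = ∫₀ˢ e^{rσ} P(σ) dσ` and its derivative
  set Gi : ℝ → ℂ := fun s => ∫ σ in (0 : ℝ)..s, Real.exp (r * σ) • P σ with hGi
  have hGii : Continuous fun σ => Real.exp (r * σ) • P σ := by fun_prop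
  have hGi' : ∀ s, HasDerivAt Gi (Real.exp (r * s) • P s) s := fun s =>
    (hGii.integral_hasStrictDerivAt 0 s).hasDerivAt
  -- the heat factor and its derivative
  have hE' : ∀ s, HasDerivAt (fun s => Real.exp (-(r * s))) (-r * Real.exp (-(r * s))) s := by
    intro s
    have := ((hasDerivAt_id s).const_mul r).neg.exp
    simpa [mul_comm] using this
  -- `F s = e^{-rs} a + e^{-rs} Gi s` is the Duhamel formula
  set F : ℝ → ℂ := fun s => Real.exp (-(r * s)) • a l k + Real.exp (-(r * s)) • Gi s with hF
  have hF' : ∀ s, HasDerivAt F (-(r : ℂ) * F s + P s) s := by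
    intro s
    have h1 : HasDerivAt (fun s => Real.exp (-(r * s)) • a l k) ((-r * Real.exp (-(r * s))) • a l k) s :=
      (hE' s).smul_const _
    have h2 : HasDerivAt (fun s => Real.exp (-(r * s)) • Gi s)
        (Real.exp (-(r * s)) • (Real.exp (r * s) • P s) + (-r * Real.exp (-(r * s))) • Gi s) s :=
      (hE' s).smul (hGi' s)
    have h3 := h1.add h2
    have hone : Real.exp (-(r * s)) * Real.exp (r * s) = 1 := by
      rw [← Real.exp_add]; simp
    have hone' : (Real.exp (-(r * s)) : ℂ) * (Real.exp (r * s) : ℂ) = 1 := by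
      rw [← Complex.ofReal_mul, hone, Complex.ofReal_one]
    have heq : (-r * Real.exp (-(r * s))) • a l k +
        (Real.exp (-(r * s)) • (Real.exp (r * s) • P s) + (-r * Real.exp (-(r * s))) • Gi s) =
        -(r : ℂ) * F s + P s := by
      simp only [hF, Complex.real_smul, Complex.ofReal_mul, Complex.ofReal_neg]
      linear_combination (P s) * hone'
    rw [heq] at h3
    exact h3
  -- on `[0, T]`, `c l s k = F s`
  have hcF : ∀ s ∈ Icc 0 T, c l s k = F s := by
    intro s hs
    have hfix := h.picardLimF_eq_picardMapF l s k
    rw [← hc] at hfix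
    have hiN : IntervalIntegrable (fun σ => (heatFactor ν k (s - σ) : ℂ) * N σ) volume 0 s :=
      (h.toPicardHyp.continuous_integrand hcc hcd l k s).intervalIntegrable _ _
    have hiS : IntervalIntegrable (fun σ => (heatFactor ν k (s - σ) : ℂ) * Sg σ) volume 0 s :=
      (h.continuous_forcing_integrand l k s).intervalIntegrable _ _
    rw [hfix, picardMapF_apply, picardMap, forcing_apply, FourierNS.clamp_of_mem hs]
    change (heatFactor ν k s : ℂ) * a l k - (∫ σ in (0:ℝ)..s, (heatFactor ν k (s - σ) : ℂ) * N σ) +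
      (∫ σ in (0:ℝ)..s, (heatFactor ν k (s - σ) : ℂ) * Sg σ) = F s
    rw [sub_add, ← intervalIntegral.integral_sub hiN hiS]
    simp only [heatFactor_apply, hF, Complex.real_smul]
    rw [sub_eq_add_neg]
    congr 1
    rw [hGi, ← intervalIntegral.integral_const_mul, ← intervalIntegral.integral_neg]
    refine intervalIntegral.integral_congr fun σ _ => ?_
    have hexp : (Real.exp (-(heatRate ν k * (s - σ))) : ℂ) =
        (Real.exp (-(heatRate ν k * s)) : ℂ) * (Real.exp (heatRate ν k * σ) : ℂ) := by
      rw [← Complex.ofReal_mul, ← Real.exp_add]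
      congr 2
      ring
    simp only [Complex.real_smul, hP, hr]
    rw [hexp]
    ring
  have key := (hF' t).hasDerivWithinAt (s := Icc 0 T)
  rw [← hcF t ht] at key
  have key2 := key.congr (fun s hs => hcF s hs) (hcF t ht)
  have hval : -(r : ℂ) * c l t k - linProjSym (fun j => U j t) (fun j => c j t) l k +
      srcProj (fun j => G j t) l k = -(r : ℂ) * c l t k + P t := by
    simp only [hP, hN, hSg]; ring
  rw [hval]
  exact key2

/-! ### Families: closure under the projected source and the forced bootstrap -/

section Family

variable {n : ℕ}

/-- **The projected source family of families is a family** (the Leray entries are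
time-independent symbols bounded by `2`). [folklore] -/
theorem IsCoeffFamily.srcProjFamily {GF : d → ℕ → ℝ → (d → ℤ) → ℂ}
    (hGF : ∀ j, IsCoeffFamily T n (GF j)) (l : d) : IsCoeffFamily T n (srcProjFamily GF l) :=
  IsCoeffFamily.finset_sum _ fun m _ =>
    (hGF m).symbol (σ := fun k => leraySym l m k) (g := 0) zero_le_two fun k => by
      simpa using norm_leraySym_le l m k

/-- **The forced bootstrap right-hand side of families is a family**:
`-νₖ CFₗ - (P linSym)ₗ + (P GF)ₗ` (`ν ≥ 0`). [folklore] -/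
theorem IsCoeffFamily.bootRHSF' (hT : 0 < T) (hν : 0 ≤ ν) {UF GF CF : d → ℕ → ℝ → (d → ℤ) → ℂ}
    (hUF : ∀ j, IsCoeffFamily T n (UF j)) (hGF : ∀ j, IsCoeffFamily T n (GF j))
    (hCF : ∀ j, IsCoeffFamily T n (CF j)) (l : d) : IsCoeffFamily T n (bootRHSF ν UF GF CF l) :=
  (IsCoeffFamily.bootRHS' hT hν hUF hCF l).add (IsCoeffFamily.srcProjFamily hGF l)

end Family

/-! ### Families of all orders for the forced Picard limit -/

/-- **Families of all orders for the forced Picard limit.** Let the drift coefficients `U` and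
the source coefficients `G` be, on `[0, T]`, the zeroth members of coefficient families `UF ⱼ`,
`GF ⱼ` of every order (in the application: the coefficients of `∂ₜⁱuⱼ`, `∂ₜⁱgⱼ`). Then for
every `n` the components of the forced Picard limit are the zeroth members of coefficient
families of order `n` on `[0, T]`: induction on `n` via
`∂ₜ cₗ = -νₖ cₗ - (P linSym)ₗ + (P G)ₗ` and the closure `IsCoeffFamily.bootRHSF'`, as
`PicardHyp.exists_coeffFamily`. [folklore] -/
theorem PicardHypF.exists_coeffFamilyF (h : PicardHypF ν T U G a) {UF GF : d → ℕ → ℝ → (d → ℤ) → ℂ}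
    (hUF : ∀ n j, IsCoeffFamily T n (UF j)) (hU0 : ∀ j, ∀ t ∈ Icc 0 T, UF j 0 t = U j t)
    (hGF : ∀ n j, IsCoeffFamily T n (GF j)) (hG0 : ∀ j, ∀ t ∈ Icc 0 T, GF j 0 t = G j t) (n : ℕ) :
    ∃ W : d → ℕ → ℝ → (d → ℤ) → ℂ, (∀ l, W l 0 = picardLimF ν T U G a l) ∧
      ∀ l, IsCoeffFamily T n (W l) := by
  set c := picardLimF ν T U G a with hc
  have base : ∀ l, IsCoeffFamily T 0 (fun _ => c l) := fun l =>
    { decay := fun i _ K => by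
        obtain ⟨C, -, hC⟩ := h.hasDecay_picardLimF K
        exact ⟨C, fun t _ => hC l t⟩
      cont := fun i _ m => (h.continuous_picardLimF l m).continuousOn
      deriv := fun i hi => absurd hi (Nat.not_lt_zero i) }
  induction n with
  | zero => exact ⟨fun l _ => c l, fun l => rfl, base⟩
  | succ n ih =>
    obtain ⟨W, hW0, hW⟩ := ih
    set D : d → ℕ → ℝ → (d → ℤ) → ℂ := fun l => bootRHSF ν UF GF W l with hD
    have hDf : ∀ l, IsCoeffFamily T n (D l) := fun l =>
      IsCoeffFamily.bootRHSF' h.hT h.hν.le (fun j => hUF n j) (fun j => hGF n j) hW l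
    refine ⟨fun l => consFamily (c l) (D l), fun l => rfl, fun l => ?_⟩
    refine ⟨fun i hi K => ?_, fun i hi m => ?_, fun i hi m t ht => ?_⟩
    · cases i with
      | zero => exact (base l).decay 0 le_rfl K
      | succ i => exact (hDf l).decay i (by omega) K
    · cases i with
      | zero => exact (base l).cont 0 le_rfl m
      | succ i => exact (hDf l).cont i (by omega) m
    · cases i with
      | zero =>
        have hd := h.hasDerivWithinAt_picardLimF l m ht
        simp only [consFamily_zero, consFamily_succ, zero_add]
        convert hd using 1
        simp only [hD, bootRHSF_apply, bootRHS_apply, projFamily_zero, srcProjFamily_apply, hW0, ← hc]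
        have hU' : (fun j => UF j 0 t) = fun j => U j t := funext fun j => hU0 j t ht
        have hG' : (fun j => GF j 0 t) = fun j => G j t := funext fun j => hG0 j t ht
        rw [hU', hG']
      | succ i =>
        simp only [consFamily_succ]
        exact (hDf l).deriv i (by omega) m t ht

end LinearisedNSFourier

end Literature.Analysis.FluidPDE

end
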